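import Summits.CriticalPhenomena.PercolationContinuityZ3.Theorems.Transplant.WedgeUniquenessLinks
import HarnessLib

/-!
# The all-arms chain in a wedge `W_m` (`d ≥ 3`, `m ≥ 1`): the exterior wedge step graph; every arm region lies in `W_m` off the box, inside a window

builds on p205010 (kernel theorem, internal audit signed; external expert review pending) — nothing in this file uses p205010.
Lane `prim-bschramm`, seat `prim-bschramm-p2` gen 18 (class C1b); helper file (`--supports stmt-CriticalPhenomena-4575 --as helper`) for the
WEDGE UNIQUENESS programme; continues `WedgeUniquenessStations/Links`.  This is the file where the RE-TUNED constants earn their keep: the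
regions of link 0 and link 1 stay in the wedge by the apex margin `x₂ + (m+1)k + 2k ≤ m x₀` (`apexW_facts`), those of link 2 because the big
first height gain `L` dominates the excursion `x₂ ≤ (3N)/2 + O(k)` and the small canonical value `C₂ + k`, those of the links `n ≥ 3`
because `x₂ = C₂ ± k ≤ H_n - k ≤ x₀`.
* §1 **`link0_goodW`, `linkS_goodW`** — every point of every arm region of the chain lies in `W_m` and off `[-N,N]^d`;
* §2 `MbigW`, `link0_windowW`, `linkS_windowW` — all regions inside `[-M, M]^d`.
(The wedge step graphs and the escape are the sibling file `WedgeUniquenessEscape`.)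
[cite: AizenmanChayesChayesFrohlichRusso1983, §4 Lemma 4.3 and Cor.] [cite: BarskyGrimmettNewman1991, Comment 6 p. 116]
-/

noncomputable section

namespace Summit.CriticalPhenomena.PercolationContinuityZ3.Theorems.Transplant

namespace WedgeUniq

open MeasureTheory Literature.Probability.Percolation Literature.Probability.LatticeModels SimpleGraph HSU OrthantUniq
open scoped Classical

variable {d : ℕ} [NeZero d]

/-! ## §1 The arm regions lie in the wedge, off the box -/

section Good

variable {p' : unitInterval} (A : ArmKit d p') (hd : 3 ≤ d) {N : ℕ} {F : Face d} {m : ℕ}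

/-- `m x₀` dominates `x₀` for `m ≥ 1`, `x₀ ≥ 0`. [folklore] -/
private theorem le_mul_of_one_le' {m : ℕ} (hm : 1 ≤ m) {a : ℤ} (ha : 0 ≤ a) : a ≤ (m : ℤ) * a := by
  have : (1 : ℤ) ≤ m := by exact_mod_cast hm
  nlinarith

/-- Monotonicity of `a ↦ m a`. [folklore] -/
private theorem mul_mono' (m : ℕ) {a b : ℤ} (h : a ≤ b) : (m : ℤ) * a ≤ m * b :=
  mul_le_mul_of_nonneg_left h (by positivity)

/-- **Link 0's regions are in `W_m` off the box.** [folklore] -/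
theorem link0_goodW (hm : 1 ≤ m) (hF : FaceOKW m N F) {x : Site d}
    (hx : x ∈ steepReg A (apexW N A.k F) (plane0W hd F.c) (sign0W F) (T0 N A.k) ∪
      shallowReg A (apexW N A.k F) (plane0W hd F.c) (sign0W F) (H0 N A.k) (c0W hd N A.k F) (t0W hd N A.k F)) :
    x ∈ wedge m ∧ x ∉ boxSet d N := by
  have hL := linkOKW_zero hd A.k hm hF
  obtain ⟨hcc, h00, hc0, -, -, h2k, h2N, h0J, -, -, hmar⟩ := apexW_facts hd A.k hm hF
  obtain ⟨hp0, hp2⟩ := plane0W_ne hd F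
  have h20 : (2 : Fin d) ≠ 0 := fun h => by have := congrArg Fin.val h; rw [fin_two_val hd] at this; simp at this
  have hJ : (J A.k : ℤ) = 8 * A.k + 8 := by simp [J]
  have hH0 : (H0 N A.k : ℤ) = N + 2 * A.k + 2 + J A.k := by simp [H0]
  -- the wedge conclusion from `|x₂ - apex₂| ≤ k` and `x₀ ≥ apex₀ - k`
  have wedge_of : ∀ {x : Site d}, |x 2 - apexW N A.k F 2| ≤ A.k → apexW N A.k F 0 - A.k ≤ x 0 → x ∈ wedge m := by
    intro x h2 h0
    rw [abs_le] at h2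
    have hm0 := mul_mono' m h0
    refine ⟨by omega, ?_⟩
    have : (m : ℤ) * (apexW N A.k F 0 - A.k) = m * apexW N A.k F 0 - m * A.k := by ring
    nlinarith
  -- the off-box conclusion by the face
  have offbox_of : ∀ {x : Site d}, |x 2 - apexW N A.k F 2| ≤ A.k → apexW N A.k F 0 - A.k ≤ x 0 →
      -(A.k : ℤ) ≤ sign0W F * (x (plane0W hd F.c) - apexW N A.k F (plane0W hd F.c)) → x ∉ boxSet d N := by
    intro x h2 h0 hs
    by_cases hc0' : F.c = 0
    · have := h00 hc0'; exact not_mem_boxSet_of_lt (j := 0) (by rw [abs_of_nonneg (by omega)]; omega)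
    · by_cases hc2' : F.c = 2
      · have hA : apexW N A.k F 2 = F.σ * (N + A.k + 1) := by rw [← hc2']; exact hcc hc0'
        rw [hF.2.2.2.2.2.1 hc2', one_mul] at hA
        rw [abs_le] at h2
        exact not_mem_boxSet_of_lt (j := 2) (by rw [abs_of_nonneg (by omega)]; omega)
      · have hpc : plane0W hd F.c = F.c := by simp [plane0W, hc0', hc2']
        have hsc : sign0W F = F.σ := by simp [sign0W, hc0', hc2']
        rw [hpc, hsc, hcc hc0'] at hs
        refine not_mem_boxSet_of_lt (j := F.c) ?_
        rcases hF.1 with h | h <;> rw [h] at hs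
        · have := le_abs_self (x F.c); nlinarith
        · have := neg_abs_le (x F.c); nlinarith
  rcases hx with hx | hx
  · obtain ⟨s1, -, s3, -, s5⟩ := steepReg_props A hL hx
    have h2 := s5 2 h20 (Ne.symm hp2)
    exact ⟨wedge_of h2 s3, offbox_of h2 s3 s1⟩
  · obtain ⟨h1, -, -, h4, -, h6⟩ := shallowReg_props A hL hx
    have h2 := h6 2 h20 (Ne.symm hp2)
    have hf := hL.facts A
    have hx0 : apexW N A.k F 0 - A.k ≤ x 0 := by have := hf.2.1; omega
    refine ⟨wedge_of h2 hx0, not_mem_boxSet_of_lt (j := 0) (by rw [abs_of_nonneg (by omega)]; omega)⟩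

/-- **Link `n+1`'s regions are in `W_m` off the box** (everything at heights `> N`; the wedge coordinate is controlled by the apex margin
for `n = 0`, by the big height `H₁` for `n = 1`, and frozen at `C₂ ± k ≤ x₀` for `n ≥ 2`). [folklore] -/
theorem linkS_goodW (hm : 1 ≤ m) (hF : FaceOKW m N F) {n : ℕ} (h : n + 1 < d) {x : Site d}
    (hx : x ∈ steepReg A (stationW hd N A.k F n) ⟨n + 1, h⟩ 1 (Tn N A.k (n + 1)) ∪
      shallowReg A (stationW hd N A.k F n) ⟨n + 1, h⟩ 1 (Hn N A.k (n + 1)) (Cn N A.k (n + 1)) (tco N A.k ⟨n + 1, h⟩)) :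
    x ∈ wedge m ∧ x ∉ boxSet d N := by
  have hL := linkOKW_succ hd A.k hm hF h
  obtain ⟨h0, -, -, h2a, h2c, -⟩ := stationW_facts hd A.k hm hF (show n < d by omega)
  obtain ⟨-, -, -, -, -, h2k, h2N, h0J, h0N, -, hmar⟩ := apexW_facts hd A.k hm hF
  obtain ⟨hJ, hH0, -, -, -, hL', hHn0, hHn1, hHn2, -, hT2, -, hC2⟩ := constants_eqs N A.k
  have hj0 : (⟨n + 1, h⟩ : Fin d) ≠ 0 := by simp [Fin.ext_iff]
  have h20 : (2 : Fin d) ≠ 0 := fun h => by have := congrArg Fin.val h; rw [fin_two_val hd] at this; simp at this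
  have hHge : (H0 N A.k : ℤ) ≤ Hn N A.k n := by exact_mod_cast (H0_le_Hn N A.k n).1
  have hHge' : (H0 N A.k : ℤ) ≤ Hn N A.k (n + 1) := by exact_mod_cast (H0_le_Hn N A.k (n + 1)).1
  -- heights: every point is at height `≥ H₀ - k > N`
  have hxN : (N : ℤ) < x 0 := by
    rcases hx with hx | hx
    · have := (steepReg_props A hL hx).2.2.1; rw [h0] at this; push_cast [hH0, hJ] at hHge this ⊢; omega
    · have := (shallowReg_props A hL hx).1; push_cast [hH0, hJ] at hHge' this ⊢; omega
  refine ⟨?_, not_mem_boxSet_of_lt (j := 0) (by rw [abs_of_nonneg (by omega)]; exact hxN)⟩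
  have hx0 : 0 ≤ x 0 := by omega
  rcases Nat.lt_or_ge n 1 with hn | hn
  · -- link 1: plane `(0,1)`, the wedge coordinate is within `k` of `apex₂`, heights `≥ H₀ - k ≥ apex₀`
    have hn0 : n = 0 := by omega
    have hne : (2 : Fin d) ≠ ⟨n + 1, h⟩ := fun e => by have := congrArg Fin.val e; rw [fin_two_val hd] at this; simp at this; omega
    have hb2 : stationW hd N A.k F n 2 = apexW N A.k F 2 := h2a (by omega)
    have h2 : |x 2 - apexW N A.k F 2| ≤ A.k ∧ apexW N A.k F 0 - A.k ≤ x 0 := by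
      rcases hx with hx | hx
      · obtain ⟨-, -, s3, -, s5⟩ := steepReg_props A hL hx
        have := s5 2 h20 hne; rw [hb2] at this; rw [h0] at s3
        exact ⟨this, by push_cast [hH0] at hHge s3; omega⟩
      · obtain ⟨s1, -, -, -, -, s6⟩ := shallowReg_props A hL hx
        have := s6 2 h20 hne; rw [hb2] at this
        exact ⟨this, by push_cast [hH0] at hHge' s1; omega⟩
    rw [abs_le] at h2
    have hm0 := mul_mono' m h2.2
    refine ⟨by omega, ?_⟩
    have : (m : ℤ) * (apexW N A.k F 0 - A.k) = m * apexW N A.k F 0 - m * A.k := by ring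
    nlinarith
  · have hmx := le_mul_of_one_le' hm hx0
    rcases Nat.lt_or_ge n 2 with hn' | hn'
    · -- link 2: plane `(0,2)`, σ = 1, from height `H₁ = H₀ + L`
      have hn1 : n = 1 := by omega
      have e2 : (⟨n + 1, h⟩ : Fin d) = 2 := Fin.ext (by rw [fin_two_val hd]; simp; omega)
      have hb2 : stationW hd N A.k F n 2 = apexW N A.k F 2 := h2a (by omega)
      have eH : Hn N A.k n = H0 N A.k + L N A.k := by subst hn1; exact hHn1
      have eT : Tn N A.k (n + 1) = Hn N A.k 1 + N + 9 * A.k + 8 := by subst hn1; exact hT2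
      have eC : Cn N A.k (n + 1) = 2 * N + 12 * A.k + 12 := by subst hn1; exact hC2
      rcases hx with hx | hx
      · obtain ⟨s1, s2, s3, -, -⟩ := steepReg_props A hL hx
        rw [e2, hb2, one_mul] at s1 s2; rw [h0] at s2 s3
        push_cast [eH, eT, hHn1, hH0, hJ, hL'] at s2 s3
        exact ⟨by omega, by omega⟩
      · obtain ⟨s1, -, -, s4, s5, -⟩ := shallowReg_props A hL hx
        rw [e2, one_mul, one_mul, tco, if_pos (fin_two_val hd)] at s4
        rw [e2, one_mul, one_mul] at s5
        push_cast [eC] at s5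
        have eH' := (constants_ge N A.k n).2.1 (by omega)
        push_cast [eH', eH, hH0, hJ, hL'] at s1
        exact ⟨s4, by omega⟩
    · -- links `n+1 ≥ 3`: the wedge coordinate is frozen at `C₂ ± k`
      have hne : (2 : Fin d) ≠ ⟨n + 1, h⟩ := fun e => by have := congrArg Fin.val e; rw [fin_two_val hd] at this; simp at this; omega
      have hb2 : stationW hd N A.k F n 2 = Cn N A.k 2 := h2c hn'
      have eHn := (constants_ge N A.k n).2.2 (by omega)
      have h2 : |x 2 - Cn N A.k 2| ≤ A.k ∧ (Hn N A.k n : ℤ) - A.k ≤ x 0 := by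
        rcases hx with hx | hx
        · obtain ⟨-, -, s3, -, s5⟩ := steepReg_props A hL hx
          have := s5 2 h20 hne; rw [hb2] at this; rw [h0] at s3
          exact ⟨this, s3⟩
        · obtain ⟨s1, -, -, -, -, s6⟩ := shallowReg_props A hL hx
          have := s6 2 h20 hne; rw [hb2] at this
          have eH' := (constants_ge N A.k n).2.1 (by omega)
          exact ⟨this, by push_cast [eH'] at s1; omega⟩
      rw [abs_le] at h2
      push_cast [hC2, eHn, hH0, hJ, hL'] at h2
      exact ⟨by omega, by nlinarith⟩

/-! ## §2 The window -/

/-- The window half-width `M = (2H_{d-1} + 3B + L + 5k + 2) + (2H_{d-1} + 3B + L + 5k + 2) + k`. [folklore] -/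
def MbigW (N k : ℕ) : ℕ :=
  (2 * Hn N k (d - 1) + 3 * Bc N k + L N k + 5 * k + 2) + (2 * Hn N k (d - 1) + 3 * Bc N k + L N k + 5 * k + 2) + k

/-- **Link 0's regions lie in the window `[-M, M]^d`.** [folklore] -/
theorem link0_windowW (hm : 1 ≤ m) (hF : FaceOKW m N F) {x : Site d}
    (hx : x ∈ steepReg A (apexW N A.k F) (plane0W hd F.c) (sign0W F) (T0 N A.k) ∪
      shallowReg A (apexW N A.k F) (plane0W hd F.c) (sign0W F) (H0 N A.k) (c0W hd N A.k F) (t0W hd N A.k F)) :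
    ∀ j, |x j| ≤ (MbigW (d := d) N A.k : ℕ) := by
  have hL := linkOKW_zero hd A.k hm hF
  obtain ⟨-, -, -, -, -, -, -, h0J, h0N, habs, -⟩ := apexW_facts hd A.k hm hF
  obtain ⟨-, hpp, -, -, hB⟩ := stationW_zero_facts hd A.k hm hF
  set M₀ : ℕ := 2 * Hn N A.k (d - 1) + 3 * Bc N A.k + L N A.k + 5 * A.k + 2 with hM₀
  have hBc := (H0_le_Hn N A.k (d - 1)).2.2
  have hH := (H0_le_Hn N A.k (d - 1)).1
  have hH0 : (H0 N A.k : ℤ) = N + 2 * A.k + 2 + J A.k := by simp [H0]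
  have hT0 : (T0 N A.k : ℤ) = 2 * H0 N A.k + 4 * A.k + 1 := by simp [T0]
  have hab : ∀ j, |apexW N A.k F j| ≤ (M₀ : ℤ) := by
    intro j
    by_cases hj : j = 0
    · rw [hj, abs_of_nonneg (by omega)]; push_cast [hM₀]; omega
    · exact (habs j hj).trans (by push_cast [hM₀]; omega)
  have hc0 : |c0W hd N A.k F| ≤ (M₀ : ℤ) := by
    rw [← hpp]; exact (hB _ (plane0W_ne hd F).1).trans (by push_cast [hM₀]; omega)
  have ht0 : |t0W hd N A.k F| ≤ (M₀ : ℤ) := by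
    have h1 := habs (plane0W hd F.c) (plane0W_ne hd F).1; rw [abs_le] at h1
    rw [t0W, abs_le]
    rcases sign0W_cases F hF.1 with h | h <;> rw [h] <;> constructor <;> push_cast [hM₀] <;> omega
  exact regions_window A hL (Mb := M₀) (Mp := M₀) hab (by rw [Nat.abs_cast]; push_cast [hM₀]; omega) hc0
    (by rw [Nat.abs_cast]; push_cast [hM₀]; omega) ht0 hx

/-- **Link `n+1`'s regions lie in the window `[-M, M]^d`.** [folklore] -/
theorem linkS_windowW (hm : 1 ≤ m) (hF : FaceOKW m N F) {n : ℕ} (h : n + 1 < d) {x : Site d}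
    (hx : x ∈ steepReg A (stationW hd N A.k F n) ⟨n + 1, h⟩ 1 (Tn N A.k (n + 1)) ∪
      shallowReg A (stationW hd N A.k F n) ⟨n + 1, h⟩ 1 (Hn N A.k (n + 1)) (Cn N A.k (n + 1)) (tco N A.k ⟨n + 1, h⟩)) :
    ∀ j, |x j| ≤ (MbigW (d := d) N A.k : ℕ) := by
  have hL := linkOKW_succ hd A.k hm hF h
  obtain ⟨-, -, -, -, -, habs⟩ := stationW_facts hd A.k hm hF (show n < d by omega)
  set M₀ : ℕ := 2 * Hn N A.k (d - 1) + 3 * Bc N A.k + L N A.k + 5 * A.k + 2 with hM₀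
  have m1 := Hn_mono N A.k (show n + 1 ≤ d - 1 by omega)
  have m2 := Tn_le N A.k (show n + 1 ≤ d - 1 by omega)
  have m3 := Cn_le N A.k (show n + 1 ≤ d - 1 by omega)
  have ht : |tco N A.k ⟨n + 1, h⟩| ≤ (M₀ : ℤ) := by
    rw [tco, abs_le]; split_ifs <;> constructor <;> push_cast [hM₀] <;> omega
  exact regions_window A hL (Mb := M₀) (Mp := M₀) habs (by rw [Nat.abs_cast]; push_cast [hM₀]; omega)
    (by rw [Nat.abs_cast]; push_cast [hM₀]; omega) (by rw [Nat.abs_cast]; push_cast [hM₀]; omega) ht hx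

end Good

end WedgeUniq

end Summit.CriticalPhenomena.PercolationContinuityZ3.Theorems.Transplant

end
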